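import Summits.ValiantsHypothesis.ValiantsHypothesis.Theorems.LacunarySymmetroidMatrixDescartesCensusNewtonCone

/-!
# `MatrixDescartes` census — the Newton cone at EQUAL EXPONENT SUMS (kernel corollary of C25)

HONEST FRAMING.  Object-search cell `pub-symmetroid`, route crux `Theses.LacunarySymmetroid.MatrixDescartes`
(ledger item stmt-ValiantsHypothesis-18050).  One reusable corollary of the tree's `Census.newton_cone_log` (C25 /
«THEOREM N»): for a TERM-sharp real fewnomial `Σ_{t<n} c_t X^{e_t}` (`e` strictly increasing, all `c_t ≠ 0`, at least
`n − 1` distinct positive roots) and indices `a < b ≤ c < d` with EQUAL EXPONENT SUMS `e_a + e_d = e_b + e_c`, the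
weights `A_t = |c_t| ∏_{u≠t}|e_t − e_u|` satisfy `A_a · A_d ≤ A_b · A_c` — concavity of `t ↦ log A_t` over the
exponents, read at a balanced pair of chords.  This is the step the cell's window theorems use over and over:
theory-2 g14's PROPOSITION C2-BOX (knots `d₁ < 2d₁ < d₃ < d₁+d₃`, `e₁+e₆ = e₃+e₄`), LEMMA C1-N (`b = c`:
`A_a A_d ≤ A_b²` at `2d₁ < d₁+d₃ < 2d₃`), engine-1 g14's THEOREM L-N (b) (kernel: `…CensusNewtonS1.lean`).
Nothing here bears on `ζ_sym`, `DoorA26` / `DoorA34`, the crux, or `VP ≠ VNP`.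

[folklore] — two instances of `newton_cone_log`, added.
-/

-- `Summit.ValiantsHypothesis.ValiantsHypothesis.…` repeats a component by the D-0017 layout
-- (single-conjunct summit), which the `dupNamespace` linter flags; the name is mandated.
set_option linter.dupNamespace false

namespace Summit.ValiantsHypothesis.ValiantsHypothesis.Theorems.LacunarySymmetroidMatrixDescartes.Census

open Polynomial Finset
open scoped BigOperators Polynomial

/-- **C25 at equal exponent sums.**  Term-sharp fewnomial, `a < b ≤ c < d`, `e_a + e_d = e_b + e_c` ⇒
`A_a A_d ≤ A_b A_c` with `A_t = |c_t| ∏_{u ≠ t} |e_t − e_u|`. [folklore] -/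
theorem newton_cone_equal_sums {n : ℕ} (e : Fin n → ℕ) (he : StrictMono e) (c : Fin n → ℝ) (hc : ∀ t, c t ≠ 0)
    (hZ : n ≤ ((∑ t, C (c t) * X ^ (e t)).roots.toFinset.filter (fun x => 0 < x)).card + 1)
    {a b c' d : Fin n} (hab : a < b) (hbc : b ≤ c') (hcd : c' < d) (hsum : e a + e d = e b + e c') :
    (|c a| * ∏ u ∈ univ.erase a, |((e a : ℕ) : ℝ) - e u|) * (|c d| * ∏ u ∈ univ.erase d, |((e d : ℕ) : ℝ) - e u|)
      ≤ (|c b| * ∏ u ∈ univ.erase b, |((e b : ℕ) : ℝ) - e u|) *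
        (|c c'| * ∏ u ∈ univ.erase c', |((e c' : ℕ) : ℝ) - e u|) := by
  set A : Fin n → ℝ := fun t => |c t| * ∏ u ∈ univ.erase t, |((e t : ℕ) : ℝ) - e u| with hA
  have hApos : ∀ t, 0 < A t := by
    intro t
    refine mul_pos (abs_pos.mpr (hc t)) (Finset.prod_pos fun u hu => abs_pos.mpr (sub_ne_zero.mpr ?_))
    exact_mod_cast fun h => (Finset.mem_erase.mp hu).1 (he.injective h).symm
  change A a * A d ≤ A b * A c'
  have had : a < d := hab.trans (lt_of_le_of_lt hbc hcd)
  have hbd : b < d := lt_of_le_of_lt hbc hcd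
  have hac : a < c' := lt_of_lt_of_le hab hbc
  have hsumR : ((e a : ℕ) : ℝ) + e d = (e b : ℝ) + e c' := by exact_mod_cast hsum
  have hea : ((e a : ℕ) : ℝ) < e b := by exact_mod_cast he hab
  have hed : ((e c' : ℕ) : ℝ) < e d := by exact_mod_cast he hcd
  have hebc : ((e b : ℕ) : ℝ) ≤ e c' := by exact_mod_cast he.monotone hbc
  -- the log inequality `L a + L d ≤ L b + L c'`
  have key : Real.log (A a) + Real.log (A d) ≤ Real.log (A b) + Real.log (A c') := by
    have h1 := newton_cone_log e he c hc hZ hab hbd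
    have h2 := newton_cone_log e he c hc hZ hac hcd
    change ((e d : ℝ) - e b) * Real.log (A a) + ((e b : ℝ) - e a) * Real.log (A d)
      ≤ ((e d : ℝ) - e a) * Real.log (A b) at h1
    change ((e d : ℝ) - e c') * Real.log (A a) + ((e c' : ℝ) - e a) * Real.log (A d)
      ≤ ((e d : ℝ) - e a) * Real.log (A c') at h2
    have hc'' : ((e c' : ℕ) : ℝ) = ((e a : ℕ) : ℝ) + ((e d : ℕ) : ℝ) - ((e b : ℕ) : ℝ) := by
      have h0 := hsumR
      linarith
    rw [hc''] at h2
    have hpos : 0 < ((e d : ℝ) - e a) := by linarith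
    have h3 : ((e d : ℝ) - e a) * (Real.log (A a) + Real.log (A d))
        ≤ ((e d : ℝ) - e a) * (Real.log (A b) + Real.log (A c')) := by
      ring_nf at h1 h2 ⊢
      linarith
    exact le_of_mul_le_mul_left h3 hpos
  have h := Real.exp_le_exp.mpr key
  rwa [Real.exp_add, Real.exp_add, Real.exp_log (hApos a), Real.exp_log (hApos d), Real.exp_log (hApos b),
    Real.exp_log (hApos c')] at h

end Summit.ValiantsHypothesis.ValiantsHypothesis.Theorems.LacunarySymmetroidMatrixDescartes.Census
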